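import Literature.Dynamics.Ergodic.PerronFrobeniusOperator
import Mathlib.Dynamics.Ergodic.AddCircle
import Mathlib.MeasureTheory.Integral.IntervalIntegral.Periodic
import HarnessLib

/-!
# The Perron–Frobenius operator of `x ↦ n x (mod 1)`: `P f(x) = (1/n) Σ_{i<n} f((x + i)/n)` (Lasota–Mackey (1.2.13))

Layer `Literature/Dynamics/Ergodic`, namespace `Literature.Dynamics.Ergodic`; sequel of `PerronFrobeniusOperator.lean`
(Dajani–Kalle Definition 6.1.1 `perronFrobenius T μ f` and `perronFrobenius_comp_ae_eq_condExp`: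
`P_T f ∘ T = 𝔼[f | T⁻¹𝓑]`) and companion of `AddCircleMultiplicationExact.lean` (`y ↦ n • y` on `ℝ/ℤ` is exact iff
`n ≥ 2`).  Written for lane `lit-hodgefound` (prover seat `lit-hodgefound-p31`).

## The printed statements

* A. Lasota, M. C. Mackey, *Chaos, Fractals, and Noise* (Applied Math. Sci. 97, Springer 1994), §4.4 Example 4.4.2
  (Galaxy text panama:430192514301980, chars 150000–172000): for the `r`-adic transformation `S(x) = rx (mod 1)`,
  «From equation (1.2.13) we have `Pf(x) = (1/r) Σ_{i=0}^{r−1} f(i/r + x/r)`».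
* S. Bezuglyi, P. E. T. Jorgensen, *Transfer Operators, Endomorphisms, and Measurable Partitions* (LNM 2217, 2018),
  §1.2 Example 1.2 (Galaxy text panama:274938036486154, chunk p0012): for `σ(x) = 2x mod 1` on `[0, 1)` with Lebesgue
  measure, «`R_σ(f)(x) := ½ (f(x/2) + f((x+1)/2))`», and (Table 1.1) `μ R_σ = μ`; eq. (1.3): for an `n`-to-one
  endomorphism, `R_σ(f)(x) = Σ_{y ∈ σ⁻¹(x)} W(y) f(y)`.

## What is formalised (theorems only)

`UnitAddCircle.perronFrobenius_nsmul_ae_eq`: for `n ≥ 1` and a measurable integrable `f : ℝ/ℤ → ℝ`, the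
Radon–Nikodym representative `perronFrobenius (fun y ↦ n • y) volume f` equals a.e. the fibre average
`x ↦ (1/n) Σ_{j<n} f(↑((x̃ + j)/n))`, `x̃ ∈ [0, 1)` the lift of `x` (`AddCircle.equivIco 1 0`).  Proof: the average
`A f(y) = (1/n) Σ_{j<n} f(y + j/n)` over the kernel `{j/n}` of `y ↦ n•y` is `𝔼[f | S⁻¹𝓑]` (translation invariance of
Haar measure and `S(y + j/n) = S y`), it equals the claimed formula composed with `S` (a shift of an `n`-periodic
sum), and `P_S f ∘ S = 𝔼[f | S⁻¹𝓑]`; an a.e. identity `u ∘ S = v ∘ S` descends to `u = v` because `S` preserves the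
measure.  Not formalised: weights `W ≠ 1/n` (Bezuglyi–Jorgensen (1.3), (1.5)), the `d`-torus / general compact-group
endomorphism version.

## References

* [LasotaMackey1994] A. Lasota, M. C. Mackey, *Chaos, Fractals, and Noise*, Applied Math. Sci. 97, Springer (1994),
  §1.2 eq. (1.2.13), §4.4 Example 4.4.2 (Galaxy text panama:430192514301980, chars 150000–172000).
* [BezuglyiJorgensen2018] S. Bezuglyi, P. E. T. Jorgensen, *Transfer Operators, Endomorphisms, and Measurable
  Partitions*, Lecture Notes in Math. 2217, Springer (2018), §1.2 Example 1.2, eqs. (1.2)–(1.3), Table 1.1 (Galaxy text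
  panama:274938036486154, chunks p0012–p0013).
* [DajaniKalle2021] K. Dajani, C. Kalle, *A First Course in Ergodic Theory*, CRC Press (2021), §6.1 Definition 6.1.1,
  §6.2 proof of Theorem 6.2.2 (held text chunks p0084, p0089).
-/

noncomputable section

open MeasureTheory MeasureTheory.Measure Set Filter Function
open scoped ENNReal

namespace Literature.Dynamics.Ergodic

namespace UnitAddCircle

/-- The lift `x ↦ x̃ ∈ [0, 1)` of `ℝ/ℤ` is measurable. [folklore] -/
private theorem measurable_equivIco_coe :
    Measurable fun x : UnitAddCircle ↦ ((AddCircle.equivIco (1 : ℝ) 0 x : Ico (0 : ℝ) (0 + 1)) : ℝ) :=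
  measurable_subtype_coe.comp (AddCircle.measurableEquivIco (1 : ℝ) 0).measurable

/-- The lift of `↑r` is the fractional part of `r`. [folklore] -/
private theorem equivIco_coe_eq_fract (r : ℝ) :
    ((AddCircle.equivIco (1 : ℝ) 0 (r : UnitAddCircle) : Ico (0 : ℝ) (0 + 1)) : ℝ) = Int.fract r := by
  rw [AddCircle.coe_equivIco_mk_apply, div_one, mul_one]

/-- `↑((t + n)/n) = ↑(t/n)` in `ℝ/ℤ`: the points `↑(t/n)`, `t ∈ ℤ`, only depend on `t mod n`. [folklore] -/
private theorem coe_add_natCast_div (n : ℕ) (hn : 0 < n) (t : ℝ) :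
    (((t + n) / n : ℝ) : UnitAddCircle) = ((t / n : ℝ) : UnitAddCircle) := by
  rw [add_div, div_self (Nat.cast_pos.2 hn).ne', AddCircle.coe_add, AddCircle.coe_period, add_zero]

/-- A sum of `n` consecutive values of an `n`-periodic sequence does not depend on where it starts. [folklore] -/
private theorem sum_range_add_eq_of_periodic {n : ℕ} {h : ℤ → ℝ} (hper : ∀ t, h (t + n) = h t) (a : ℤ) :
    ∑ j ∈ Finset.range n, h (j + a) = ∑ j ∈ Finset.range n, h j := by
  -- one step up
  have step : ∀ k : ℤ, ∑ j ∈ Finset.range n, h (j + (k + 1)) = ∑ j ∈ Finset.range n, h (j + k) := by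
    intro k
    have h1 : ∑ j ∈ Finset.range (n + 1), h (j + k) = ∑ j ∈ Finset.range n, h ((j + 1 : ℕ) + k) + h ((0 : ℕ) + k) :=
      Finset.sum_range_succ' (fun j ↦ h (j + k)) n
    have h2 : ∑ j ∈ Finset.range (n + 1), h (j + k) = ∑ j ∈ Finset.range n, h (j + k) + h (n + k) :=
      Finset.sum_range_succ (fun j ↦ h (j + k)) n
    have h3 : h ((n : ℤ) + k) = h ((0 : ℕ) + k) := by
      rw [Nat.cast_zero, zero_add, add_comm, hper]
    have h4 : ∑ j ∈ Finset.range n, h ((j + 1 : ℕ) + k) = ∑ j ∈ Finset.range n, h (j + (k + 1)) :=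
      Finset.sum_congr rfl fun j _ ↦ by push_cast; ring_nf
    linarith
  induction a using Int.induction_on with
  | zero => simp
  | succ k ih => rw [step, ih]
  | pred k ih =>
    have := step (-(k : ℤ) - 1)
    rw [show -(k : ℤ) - 1 + 1 = -k from by ring] at this
    rw [← this]
    exact ih

end UnitAddCircle

open UnitAddCircle in
/-- **The Perron–Frobenius operator of the `n`-fold map `S(x) = n x (mod 1)` of `ℝ/ℤ` with Lebesgue (Haar)
measure: `P_S f(x) = (1/n) Σ_{i=0}^{n−1} f((x + i)/n)`** (Lasota–Mackey (1.2.13): «`Pf(x) = (1/r) Σ_{i=0}^{r−1}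
f(i/r + x/r)`»; Bezuglyi–Jorgensen Example 1.2: «`R_σ(f)(x) = ½(f(x/2) + f((x+1)/2))`» for `σ(x) = 2x mod 1`),
here for `S y = n • y` on `UnitAddCircle = ℝ/ℤ`, `x ∈ ℝ/ℤ` lifted to `[0, 1)`, `f` measurable and integrable, as an
a.e. identity for the Radon–Nikodym representative `perronFrobenius`.  Proof: by `perronFrobenius_comp_ae_eq_condExp`,
`P_S f ∘ S = 𝔼[f | S⁻¹𝓑]`, and the right-hand side composed with `S` is the average of `f` over the translates by the
kernel `{j/n}` of `S`, which is `𝔼[f | S⁻¹𝓑]` by translation invariance of Haar measure; an a.e. identity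
`u ∘ S = v ∘ S` descends to `u = v` since `S` preserves the measure.
[cite: LasotaMackey1994, §1.2 eq. (1.2.13) and §4.4 Example 4.4.2 (Galaxy text panama:430192514301980, chars 150000–172000)]
[cite: BezuglyiJorgensen2018, §1.2 Example 1.2 eqs. (1.2)–(1.3) (Galaxy text panama:274938036486154, chunks p0012–p0013)] -/
theorem UnitAddCircle.perronFrobenius_nsmul_ae_eq {n : ℕ} (hn : 0 < n) {f : UnitAddCircle → ℝ}
    (hfm : Measurable f) (hf : Integrable f volume) :
    perronFrobenius (fun y : UnitAddCircle ↦ n • y) volume f =ᵐ[volume]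
      fun x ↦ (n : ℝ)⁻¹ * ∑ j ∈ Finset.range n, f ((((AddCircle.equivIco (1 : ℝ) 0 x : ℝ) + j) / n : ℝ) : UnitAddCircle) := by
  set S : UnitAddCircle → UnitAddCircle := fun y ↦ n • y with hSdef
  have hn0 : (n : ℝ) ≠ 0 := (Nat.cast_pos.2 hn).ne'
  -- `S` preserves Haar measure
  have hS : MeasurePreserving S volume volume := by
    have h := measurePreserving_zsmul (volume : Measure UnitAddCircle) (n := (n : ℤ)) (by exact_mod_cast hn.ne')
    simpa only [natCast_zsmul] using h
  -- the formula `F` downstairs and the average `A` upstairs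
  set F : UnitAddCircle → ℝ := fun x ↦ (n : ℝ)⁻¹ * ∑ j ∈ Finset.range n,
    f ((((AddCircle.equivIco (1 : ℝ) 0 x : ℝ) + j) / n : ℝ) : UnitAddCircle) with hFdef
  set A : UnitAddCircle → ℝ := fun y ↦ (n : ℝ)⁻¹ * ∑ j ∈ Finset.range n,
    f (y + (((j : ℝ) / n : ℝ) : UnitAddCircle)) with hAdef
  have hFm : Measurable F := by
    refine measurable_const.mul (Finset.measurable_sum _ fun j _ ↦ hfm.comp ?_)
    exact AddCircle.measurable_mk'.comp ((measurable_equivIco_coe.add_const _).div_const _)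
  -- `F ∘ S = A`
  have hFS : ∀ y, F (S y) = A y := by
    intro y
    obtain ⟨r, hr, rfl⟩ : ∃ r : ℝ, r ∈ Ico (0 : ℝ) 1 ∧ (r : UnitAddCircle) = y :=
      ⟨(AddCircle.equivIco (1 : ℝ) 0 y : ℝ), ⟨(AddCircle.equivIco (1 : ℝ) 0 y).2.1,
        (AddCircle.equivIco (1 : ℝ) 0 y).2.2.trans_eq (zero_add 1)⟩, AddCircle.coe_equivIco⟩
    have hSr : S r = ((n * r : ℝ) : UnitAddCircle) := by
      simp only [hSdef, ← AddCircle.coe_nsmul, nsmul_eq_mul]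
    simp only [hFdef, hAdef, hSr, equivIco_coe_eq_fract]
    congr 1
    -- `fract(n r) = n r - m`, `m = ⌊n r⌋`, and the summands are `f(r + (j - m)/n)`
    set m : ℤ := ⌊(n : ℝ) * r⌋ with hm
    have hsummand : ∀ j : ℕ, ((((Int.fract ((n : ℝ) * r)) + j) / n : ℝ) : UnitAddCircle) =
        (r : UnitAddCircle) + ((((j : ℤ) - m : ℤ) : ℝ) / n : ℝ) := by
      intro j
      rw [Int.fract, ← AddCircle.coe_add]
      congr 1
      push_cast
      field_simp
      ring
    simp_rw [hsummand]
    -- periodicity in the integer parameter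
    have hper : ∀ t : ℤ, f ((r : UnitAddCircle) + ((((t + n : ℤ) : ℝ) / n : ℝ) : UnitAddCircle)) =
        f ((r : UnitAddCircle) + (((t : ℝ) / n : ℝ) : UnitAddCircle)) := by
      intro t
      push_cast
      rw [coe_add_natCast_div n hn]
    have h := sum_range_add_eq_of_periodic (h := fun t : ℤ ↦
      f ((r : UnitAddCircle) + (((t : ℝ) / n : ℝ) : UnitAddCircle))) hper (-m)
    convert h using 2 with j _ j _
    · push_cast; ring_nf
    · push_cast; ring_nf
  -- `A = 𝔼[f | S⁻¹𝓑]`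
  have hm : MeasurableSpace.comap S (AddCircle.measureSpace (1 : ℝ)).toMeasurableSpace ≤
      (AddCircle.measureSpace (1 : ℝ)).toMeasurableSpace := hS.measurable.comap_le
  have hAint : Integrable A volume :=
    (integrable_finsetSum _ fun j _ ↦ hf.comp_add_right _).const_mul _
  have hker : ∀ j : ℕ, S ((((j : ℝ) / n : ℝ) : UnitAddCircle)) = 0 := by
    intro j
    simp only [hSdef, ← AddCircle.coe_nsmul, nsmul_eq_mul]
    rw [mul_div_assoc', mul_div_cancel_left₀ _ hn0]
    exact (AddCircle.coe_eq_zero_iff (1 : ℝ)).2 ⟨j, by simp⟩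
  have hAcond : A =ᵐ[volume] volume[f | MeasurableSpace.comap S (AddCircle.measureSpace (1 : ℝ)).toMeasurableSpace] := by
    refine ae_eq_condExp_of_forall_setIntegral_eq hm hf (fun _ _ _ ↦ hAint.integrableOn) ?_ ?_
    · rintro _ ⟨B, hB, rfl⟩ -
      -- `∫_{S⁻¹B} f(y + j/n) dy = ∫_{S⁻¹B} f` for each `j`, by translation invariance and `S(j/n) = 0`
      have hj : ∀ j : ℕ, ∫ y in S ⁻¹' B, f (y + (((j : ℝ) / n : ℝ) : UnitAddCircle)) ∂volume =
          ∫ y in S ⁻¹' B, f y ∂volume := by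
        intro j
        set c : UnitAddCircle := (((j : ℝ) / n : ℝ) : UnitAddCircle)
        rw [← integral_indicator (hS.measurable hB), ← integral_indicator (hS.measurable hB)]
        have hind : (S ⁻¹' B).indicator (fun y ↦ f (y + c)) = fun y ↦ ((S ⁻¹' B).indicator f) (y + c) := by
          funext y
          have hmem : y + c ∈ S ⁻¹' B ↔ y ∈ S ⁻¹' B := by
            simp only [mem_preimage, hSdef, smul_add]
            rw [show n • c = 0 from hker j, add_zero]
          by_cases hy : y ∈ S ⁻¹' B
          · rw [indicator_of_mem hy, indicator_of_mem (hmem.2 hy)]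
          · rw [indicator_of_notMem hy, indicator_of_notMem (fun h ↦ hy (hmem.1 h))]
        rw [hind]
        exact integral_add_right_eq_self _ c
      rw [integral_const_mul, integral_finsetSum _ fun j _ ↦ (hf.comp_add_right _).integrableOn]
      simp_rw [hj]
      rw [Finset.sum_const, Finset.card_range, nsmul_eq_mul, ← mul_assoc, inv_mul_cancel₀ hn0, one_mul]
    · have hSm : Measurable[MeasurableSpace.comap S (AddCircle.measureSpace (1 : ℝ)).toMeasurableSpace] S :=
        measurable_iff_comap_le.2 le_rfl
      have : A = F ∘ S := funext fun y ↦ (hFS y).symm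
      rw [this]
      exact (hFm.comp hSm).stronglyMeasurable.aestronglyMeasurable
  -- `P_S f ∘ S = 𝔼[f | S⁻¹𝓑] = A = F ∘ S` a.e., and descend along the measure-preserving `S`
  have hPS : perronFrobenius S volume f ∘ S =ᵐ[volume] F ∘ S := by
    have h1 := perronFrobenius_comp_ae_eq_condExp hS hf
    filter_upwards [h1, hAcond] with y hy hA
    rw [hy, ← hA, Function.comp_apply, hFS]
  have hne : MeasurableSet {x | perronFrobenius S volume f x ≠ F x} :=
    (measurableSet_eq_fun (measurable_perronFrobenius S volume f) hFm).compl
  have h0 : volume {x | perronFrobenius S volume f x ≠ F x} = 0 := by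
    rw [← hS.measure_preimage hne.nullMeasurableSet]
    refine measure_eq_zero_iff_ae_notMem.2 ?_
    filter_upwards [hPS] with y hy
    simpa using hy
  refine (measure_eq_zero_iff_ae_notMem.1 h0).mono fun x hx ↦ ?_
  have hx' : perronFrobenius S volume f x = F x := by simpa using hx
  exact hx'

end Literature.Dynamics.Ergodic
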